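import Summits.CriticalPhenomena.SAWScalingLimit.Theses.SAWZoomRigidity
import Literature.Probability.RandomPlanarGeometry.ConformalRestrictionHolds
import HarnessLib

/-!
# `LSWRestrictionFact` (route SAWZoomRigidity, item stmt-CriticalPhenomena-0775) — proved

The support item `LSWRestrictionFact` of route SAWZoomRigidity asks for the Lawler–Schramm–Werner
characterisation of chordal SLE_{8/3} by conformal restriction, guarded by the two named facts
`exists_isSLECurve` and `IsSLECurve.map_eq`:

`exists_isSLECurve → IsSLECurve.map_eq → ∀ P, P.IsChordal → (conformal covariance) →
(two-sided restriction for Jordan sub-domains with the same marked points) →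
(carried by simple boundary-avoiding curves) → ∀ D, IsSLELaw (8/3) D (P D)`.

Behind the two guards the body is *verbatim* the Literature named fact
`Literature.Probability.RandomPlanarGeometry.LawlerSchrammWerner2003`
(`ConformalRestriction.lean`; LSW 2003, p. 5 result 2, assembled from Prop. 3.3, Prop. 4.1,
Thm. 6.1 and Cor. 8.6), which is an unconditional theorem of the tree:
`Literature.Probability.RandomPlanarGeometry.LawlerSchrammWerner2003_holds`
(`ConformalRestrictionHolds.lean`). The two guards are not used.

References: G. F. Lawler, O. Schramm, W. Werner, *Conformal restriction: the chordal case*,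
J. Amer. Math. Soc. 16 (2003), 917–955 (arXiv:math/0209343), p. 5 results 1–2, Prop. 3.3,
Thm. 6.1, Cor. 8.6.
-/

namespace Summit.CriticalPhenomena.SAWScalingLimit.Theorems

/-- **`LSWRestrictionFact` holds** (item stmt-CriticalPhenomena-0775 of route SAWZoomRigidity):
given (unused) existence and uniqueness-in-law of chordal SLE, a chordal family on Dobrushin
domains which is conformally covariant, has the two-sided restriction property and is carried by
simple curves meeting the boundary only at the marked points is, in every domain, the chordal
SLE_{8/3} law. Immediate from the discharged Literature fact
`Literature.Probability.RandomPlanarGeometry.LawlerSchrammWerner2003_holds`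
(Lawler–Schramm–Werner 2003, p. 5 result 2; Prop. 3.3, Thm. 6.1, Cor. 8.6). -/
theorem LSWRestrictionFact_proof :
    Summit.CriticalPhenomena.SAWScalingLimit.Theses.SAWZoomRigidity.LSWRestrictionFact := by
  unfold Summit.CriticalPhenomena.SAWScalingLimit.Theses.SAWZoomRigidity.LSWRestrictionFact
  intro _ _
  exact Literature.Probability.RandomPlanarGeometry.LawlerSchrammWerner2003_holds

end Summit.CriticalPhenomena.SAWScalingLimit.Theorems
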